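/-
Origin: expansion seat `planner-pub-hodgecm-pv02-g3-0`, handover #15 2026-08-18T06:32:59Z (`HOME/pub-hodgecm-pv02-g3/lean/Pv02g3/PerL34/ClassVanishing.lean`, md5 c8c329a6, 294 lines);
landed by the gen-7 packager in gate run 25 as `HodgeCM/PerL34/ClassVanishing.lean` (import ^import Pv[0-9]+g[0-9]+\.PerL34\.→import HodgeCM.PerL34. ×3; stripped 2 #print/#check/#eval lines).
-/
/-
Origin: planner-pub-hodgecm-pv02-g3-0 (unit pub-hodgecm-pv02-g3, DAG-NODE PROVER #02 gen 3), 2026-08-18.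
Proposed tree path: `HodgeCM/PerL34/ClassVanishing.lean` (new, additive).  Imports my `OrbitGlue`, `PartialFractions`,
`GenericLine` (tree names after landing).  KERNEL: nothing cited, nothing asserted.
-/
import Summits.HodgeConjecture.HodgeCM.PerL34.OrbitGlue
import Summits.HodgeConjecture.HodgeCM.PerL34.PartialFractions
import Summits.HodgeConjecture.HodgeCM.PerL34.GenericLine

/-!
# K1: the class numerators vanish (partial fractions along a generic complex line) — and `OrbitSpansDisjoint`

`classVanishing : ClassVanishing` by restricting the balanced identity `Σ_s (a_s DZ_s − b_s OM_s)/ℓ_s² = 0` to the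
lines `t ↦ (t, m t)` for two slopes `m` outside a finite bad set, regrouping by pole and applying
`PartialFractions.pf_unique`.  Consequently `orbitSpansDisjoint : OrbitSpansDisjoint` — the `T`-free residual of the
S1 strength verdict is DISCHARGED — and `splitHolConfig : S1StrengthCR.SplitHolConfig` (no hypothesis).  The
unconditional verdict theorems are in `S1Verdict.lean`.
-/

noncomputable section

open Matrix Polynomial

namespace HodgeCM
namespace PerL34
namespace SplitHolForms

open HodgeCM.PerL34.BallModel HodgeCM.PerL34.BallSpans HodgeCM.PerL34.LineClass HodgeCM.PerL34.GenericLine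
  HodgeCM.PerL34.PartialFractions

section K1

variable (a b : U21 → ℂ)

/-- Affine coefficients of the combined numerator `a_s DZ_s − b_s OM_s`. -/
def nuA (s : U21) (j : Fin 2) : ℂ :=
  a s * (mat s 0 (Fin.castSucc j) * mat s 2 0 - mat s 0 0 * mat s 2 (Fin.castSucc j)) -
    b s * (mat s 0 0 * mat s 1 (Fin.castSucc j) - mat s 1 0 * mat s 0 (Fin.castSucc j))

/-- (Ported verbatim from the HodgeCMPerL package; no docstring in the source.) -/
def nuB (s : U21) (j : Fin 2) : ℂ :=
  a s * (mat s 0 (Fin.castSucc j) * mat s 2 1 - mat s 0 1 * mat s 2 (Fin.castSucc j)) -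
    b s * (mat s 0 1 * mat s 1 (Fin.castSucc j) - mat s 1 1 * mat s 0 (Fin.castSucc j))

/-- (Ported verbatim from the HodgeCMPerL package; no docstring in the source.) -/
def nuC (s : U21) (j : Fin 2) : ℂ :=
  a s * (mat s 0 (Fin.castSucc j) * mat s 2 2 - mat s 0 2 * mat s 2 (Fin.castSucc j)) -
    b s * (mat s 0 2 * mat s 1 (Fin.castSucc j) - mat s 1 2 * mat s 0 (Fin.castSucc j))

/-- (Ported verbatim from the HodgeCMPerL package; no docstring in the source.) -/
theorem nu_affine (s : U21) (x : Ball) (j : Fin 2) :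
    a s * DZ s x j - b s * OM s x j = nuA a b s j * x.1 0 + nuB a b s j * x.1 1 + nuC a b s j := by
  simp only [DZ, OM, W3_apply, nuA, nuB, nuC]
  ring

/-- `g v m = v₁ + m v₂`: along the line of slope `m`, `ℓ_s = s₂₂ (g (cl s) m · t + 1)`. -/
def gl (v : ℂ × ℂ) (m : ℂ) : ℂ := v.1 + m * v.2

/-- (Ported verbatim from the HodgeCMPerL package; no docstring in the source.) -/
theorem W3_line (s : U21) (m t : ℂ) (h : t ∈ lineParam m) :
    W3 s (linePt m t h) 2 = mat s 2 2 * (gl (cl s) m * t + 1) := by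
  have h22 := mat_22_ne_zero s
  simp only [W3_apply, linePt_val_zero, linePt_val_one, gl, cl]
  field_simp

/-- (Ported verbatim from the HodgeCMPerL package; no docstring in the source.) -/
theorem nu_line (s : U21) (m t : ℂ) (h : t ∈ lineParam m) (j : Fin 2) :
    a s * DZ s (linePt m t h) j - b s * OM s (linePt m t h) j =
      (nuA a b s j + m * nuB a b s j) * t + nuC a b s j := by
  rw [nu_affine, linePt_val_zero, linePt_val_one]
  ring

/-- The finite set of bad slopes. -/
def BAD (S : Finset U21) : Finset ℂ :=
  S.image (fun s => -(cl s).1 / (cl s).2) ∪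
    (S ×ˢ S).image (fun p => -((cl p.1).1 - (cl p.2).1) / ((cl p.1).2 - (cl p.2).2))

/-- (Ported verbatim from the HodgeCMPerL package; no docstring in the source.) -/
theorem gl_ne_zero {S : Finset U21} {m : ℂ} (hm : m ∉ BAD S) {s : U21} (hs : s ∈ S) (hv : cl s ≠ 0) :
    gl (cl s) m ≠ 0 := by
  intro hg
  simp only [gl] at hg
  by_cases h2 : (cl s).2 = 0
  · apply hv
    rw [h2, mul_zero, add_zero] at hg
    exact Prod.ext hg h2
  · apply hm
    simp only [BAD, Finset.mem_union, Finset.mem_image]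
    left
    refine ⟨s, hs, ?_⟩
    field_simp
    linear_combination -hg

/-- (Ported verbatim from the HodgeCMPerL package; no docstring in the source.) -/
theorem gl_injOn {S : Finset U21} {m : ℂ} (hm : m ∉ BAD S) {s s' : U21} (hs : s ∈ S) (hs' : s' ∈ S)
    (hg : gl (cl s) m = gl (cl s') m) : cl s = cl s' := by
  by_contra hne
  simp only [gl] at hg
  by_cases h2 : (cl s).2 = (cl s').2
  · apply hne
    have h1 : (cl s).1 = (cl s').1 := by rw [h2] at hg; linear_combination hg
    exact Prod.ext h1 h2
  · apply hm
    simp only [BAD, Finset.mem_union, Finset.mem_image, Finset.mem_product]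
    right
    refine ⟨(s, s'), ⟨hs, hs'⟩, ?_⟩
    have h2' : (cl s).2 - (cl s').2 ≠ 0 := sub_ne_zero.mpr h2
    field_simp
    linear_combination -hg

/-- The class polynomial along the line of slope `m` (component `j`). -/
def Pv (S : Finset U21) (v : ℂ × ℂ) (m : ℂ) (j : Fin 2) : ℂ[X] :=
  ∑ s ∈ S.filter (fun s => cl s = v),
    ((mat s 2 2)⁻¹ ^ 2) • (C (nuA a b s j + m * nuB a b s j) * X + C (nuC a b s j))

/-- (Ported verbatim from the HodgeCMPerL package; no docstring in the source.) -/
theorem natDegree_Pv_le (S : Finset U21) (v : ℂ × ℂ) (m : ℂ) (j : Fin 2) : (Pv a b S v m j).natDegree ≤ 1 := by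
  unfold Pv
  refine Polynomial.natDegree_sum_le_of_forall_le _ _ fun s _ => ?_
  exact (Polynomial.natDegree_smul_le _ _).trans Polynomial.natDegree_linear_le

/-- (Ported verbatim from the HodgeCMPerL package; no docstring in the source.) -/
theorem coeff_Pv_one (S : Finset U21) (v : ℂ × ℂ) (m : ℂ) (j : Fin 2) :
    (Pv a b S v m j).coeff 1 =
      ∑ s ∈ S.filter (fun s => cl s = v), (mat s 2 2)⁻¹ ^ 2 * (nuA a b s j + m * nuB a b s j) := by
  simp only [Pv, Polynomial.finsetSum_coeff, Polynomial.coeff_smul, Polynomial.coeff_add,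
    Polynomial.coeff_C_mul, Polynomial.coeff_X_one, Polynomial.coeff_C_succ, smul_eq_mul]
  refine Finset.sum_congr rfl fun s _ => ?_
  ring

/-- (Ported verbatim from the HodgeCMPerL package; no docstring in the source.) -/
theorem coeff_Pv_zero (S : Finset U21) (v : ℂ × ℂ) (m : ℂ) (j : Fin 2) :
    (Pv a b S v m j).coeff 0 = ∑ s ∈ S.filter (fun s => cl s = v), (mat s 2 2)⁻¹ ^ 2 * nuC a b s j := by
  simp only [Pv, Polynomial.finsetSum_coeff, Polynomial.coeff_smul, Polynomial.coeff_add,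
    Polynomial.coeff_C_mul, Polynomial.coeff_X_zero, Polynomial.coeff_C_zero, smul_eq_mul]
  refine Finset.sum_congr rfl fun s _ => ?_
  ring

/-- (Ported verbatim from the HodgeCMPerL package; no docstring in the source.) -/
theorem eval_Pv (S : Finset U21) (v : ℂ × ℂ) (m : ℂ) (j : Fin 2) (t : ℂ) :
    (Pv a b S v m j).eval t =
      ∑ s ∈ S.filter (fun s => cl s = v), (mat s 2 2)⁻¹ ^ 2 * ((nuA a b s j + m * nuB a b s j) * t + nuC a b s j) := by
  simp only [Pv, Polynomial.eval_finsetSum, Polynomial.eval_smul, Polynomial.eval_add, Polynomial.eval_mul,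
    Polynomial.eval_C, Polynomial.eval_X, smul_eq_mul]

/-- **The core**: for a slope outside the bad set, every class polynomial vanishes. -/
theorem Pv_eq_zero (S : Finset U21)
    (hK0 : ∀ (x : Ball) (j : Fin 2), ∑ s ∈ S, (a s * DZ s x j - b s * OM s x j) / W3 s x 2 ^ 2 = 0)
    {m : ℂ} (hm : m ∉ BAD S) (v : ℂ × ℂ) (j : Fin 2) : Pv a b S v m j = 0 := by
  classical
  -- the pole data
  set S' := S.filter (fun s => cl s ≠ 0) with hS'
  let ρ : U21 → ℂ := fun s => -1 / gl (cl s) m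
  set I : Finset ℂ := S'.image ρ with hI
  let p : ℂ → ℂ[X] := fun r =>
    ∑ s ∈ S'.filter (fun s => ρ s = r),
      ((mat s 2 2 ^ 2 * gl (cl s) m ^ 2)⁻¹) • (C (nuA a b s j + m * nuB a b s j) * X + C (nuC a b s j))
  let p₀ : ℂ[X] := Pv a b S 0 m j
  have hmemS' : ∀ s ∈ S', s ∈ S ∧ cl s ≠ 0 := fun s hs => Finset.mem_filter.mp hs
  -- hypotheses of `pf_unique`
  have hp : ∀ r ∈ I, (p r).natDegree ≤ 1 := by
    intro r _
    refine Polynomial.natDegree_sum_le_of_forall_le _ _ fun s _ => ?_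
    exact (Polynomial.natDegree_smul_le _ _).trans Polynomial.natDegree_linear_le
  have hTI : ∀ t ∈ lineParam m, t ∉ I := by
    intro t ht htI
    obtain ⟨s, hs, hst⟩ := Finset.mem_image.mp htI
    have hg := gl_ne_zero hm (hmemS' s hs).1 (hmemS' s hs).2
    have hW := W3_2_ne_zero s (linePt m t ht)
    rw [W3_line, ← hst] at hW
    apply hW
    simp only [ρ]
    field_simp
    ring
  have hid : ∀ t ∈ lineParam m, p₀.eval t + ∑ r ∈ I, (p r).eval t / (t - r) ^ 2 = 0 := by
    intro t ht
    have h0 := hK0 (linePt m t ht) j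
    rw [← Finset.sum_filter_add_sum_filter_not S (fun s => cl s = 0)] at h0
    -- the constant class
    have hc : ∑ s ∈ S.filter (fun s => cl s = 0),
        (a s * DZ s (linePt m t ht) j - b s * OM s (linePt m t ht) j) / W3 s (linePt m t ht) 2 ^ 2 = p₀.eval t := by
      rw [show p₀ = Pv a b S 0 m j from rfl, eval_Pv]
      refine Finset.sum_congr rfl fun s hs => ?_
      have hv : cl s = 0 := (Finset.mem_filter.mp hs).2
      have h22 := mat_22_ne_zero s
      rw [nu_line, W3_line, hv]
      simp only [gl, Prod.fst_zero, Prod.snd_zero, mul_zero, add_zero, zero_mul, zero_add, mul_one]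
      field_simp
    -- the polar classes, regrouped by pole
    have hpol : ∑ s ∈ S.filter (fun s => ¬cl s = 0),
        (a s * DZ s (linePt m t ht) j - b s * OM s (linePt m t ht) j) / W3 s (linePt m t ht) 2 ^ 2 =
          ∑ r ∈ I, (p r).eval t / (t - r) ^ 2 := by
      rw [show S.filter (fun s => ¬cl s = 0) = S' from rfl]
      rw [← Finset.sum_fiberwise_of_maps_to (s := S') (t := I) (g := ρ)
        (fun s hs => Finset.mem_image_of_mem ρ hs)]
      refine Finset.sum_congr rfl fun r _ => ?_
      simp only [p, Polynomial.eval_finsetSum, Polynomial.eval_smul, Polynomial.eval_add, Polynomial.eval_mul,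
        Polynomial.eval_C, Polynomial.eval_X, smul_eq_mul, Finset.sum_div]
      refine Finset.sum_congr rfl fun s hs => ?_
      obtain ⟨hsS', hsr⟩ := Finset.mem_filter.mp hs
      have hg := gl_ne_zero hm (hmemS' s hsS').1 (hmemS' s hsS').2
      have h22 := mat_22_ne_zero s
      have htr : t - r ≠ 0 := by
        rw [← hsr]; simp only [ρ]
        intro h0'
        have hW := W3_2_ne_zero s (linePt m t ht)
        rw [W3_line] at hW
        apply hW
        have : t = -1 / gl (cl s) m := sub_eq_zero.mp h0'
        rw [this]; field_simp; ring
      rw [nu_line, W3_line, ← hsr]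
      simp only [ρ]
      have hlin : gl (cl s) m * t + 1 = gl (cl s) m * (t - -1 / gl (cl s) m) := by
        field_simp
        ring
      rw [hlin]
      field_simp
    rw [hc, hpol] at h0
    exact h0
  obtain ⟨hp0, hpr⟩ := pf_unique I p hp p₀ (lineParam_infinite m) hTI hid
  -- read off the class `v`
  by_cases hv : v = 0
  · subst hv; exact hp0
  by_cases hne : (S.filter (fun s => cl s = v)).Nonempty
  · obtain ⟨s₁, hs₁⟩ := hne
    obtain ⟨hs₁S, hs₁v⟩ := Finset.mem_filter.mp hs₁
    have hs₁S' : s₁ ∈ S' := Finset.mem_filter.mpr ⟨hs₁S, hs₁v ▸ hv⟩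
    have hg₁ : gl v m ≠ 0 := hs₁v ▸ gl_ne_zero hm hs₁S (hs₁v ▸ hv)
    have hzero := hpr (ρ s₁) (Finset.mem_image_of_mem ρ hs₁S')
    -- the fibre of `ρ s₁` is the class of `v`
    have hfib : S'.filter (fun s => ρ s = ρ s₁) = S.filter (fun s => cl s = v) := by
      ext s
      simp only [Finset.mem_filter, hS']
      constructor
      · rintro ⟨⟨hsS, hs0⟩, hr⟩
        refine ⟨hsS, ?_⟩
        have hgg : gl (cl s) m = gl (cl s₁) m := by
          have hg := gl_ne_zero hm hsS hs0
          have hg' := gl_ne_zero hm hs₁S (hs₁v ▸ hv)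
          simp only [ρ] at hr
          field_simp at hr
          linear_combination hr
        rw [← hs₁v]
        exact gl_injOn hm hsS hs₁S hgg
      · rintro ⟨hsS, hsv⟩
        refine ⟨⟨hsS, hsv ▸ hv⟩, ?_⟩
        simp only [ρ, hsv, hs₁v]
    have hscale : p (ρ s₁) = (gl v m ^ 2)⁻¹ • Pv a b S v m j := by
      simp only [p, hfib, Pv, Finset.smul_sum, smul_smul]
      refine Finset.sum_congr rfl fun s hs => ?_
      have hsv : cl s = v := (Finset.mem_filter.mp hs).2
      rw [hsv, mul_inv, inv_pow, mul_comm]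
    rw [hscale] at hzero
    exact (smul_eq_zero.mp hzero).resolve_left (inv_ne_zero (pow_ne_zero _ hg₁))
  · rw [Finset.not_nonempty_iff_eq_empty] at hne
    simp [Pv, hne]

/-- **K1.** -/
theorem classVanishing : ClassVanishing := by
  classical
  intro S a b hK0 v x j
  obtain ⟨m, hm⟩ := Infinite.exists_notMem_finset (BAD S)
  obtain ⟨m', hm'⟩ := Infinite.exists_notMem_finset (insert m (BAD S))
  rw [Finset.mem_insert, not_or] at hm'
  have h1 := congrArg (fun q => q.coeff 1) (Pv_eq_zero a b S hK0 hm v j)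
  have h1' := congrArg (fun q => q.coeff 1) (Pv_eq_zero a b S hK0 hm'.2 v j)
  have h0 := congrArg (fun q => q.coeff 0) (Pv_eq_zero a b S hK0 hm v j)
  simp only [coeff_Pv_one, coeff_Pv_zero, Polynomial.coeff_zero] at h1 h1' h0
  set F := S.filter (fun s => cl s = v)
  have hA : ∑ s ∈ F, (mat s 2 2)⁻¹ ^ 2 * nuA a b s j + m * ∑ s ∈ F, (mat s 2 2)⁻¹ ^ 2 * nuB a b s j = 0 := by
    rw [Finset.mul_sum, ← Finset.sum_add_distrib, ← h1]
    refine Finset.sum_congr rfl fun s _ => ?_; ring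
  have hA' : ∑ s ∈ F, (mat s 2 2)⁻¹ ^ 2 * nuA a b s j + m' * ∑ s ∈ F, (mat s 2 2)⁻¹ ^ 2 * nuB a b s j = 0 := by
    rw [Finset.mul_sum, ← Finset.sum_add_distrib, ← h1']
    refine Finset.sum_congr rfl fun s _ => ?_; ring
  have hB : ∑ s ∈ F, (mat s 2 2)⁻¹ ^ 2 * nuB a b s j = 0 := by
    have : (m - m') * ∑ s ∈ F, (mat s 2 2)⁻¹ ^ 2 * nuB a b s j = 0 := by linear_combination hA - hA'
    exact (mul_eq_zero.mp this).resolve_left (sub_ne_zero.mpr (fun h => hm'.1 h.symm))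
  have hA0 : ∑ s ∈ F, (mat s 2 2)⁻¹ ^ 2 * nuA a b s j = 0 := by
    rw [hB, mul_zero, add_zero] at hA; exact hA
  -- assemble `Q`
  have hQ : Q S a b v x j = (∑ s ∈ F, (mat s 2 2)⁻¹ ^ 2 * nuA a b s j) * x.1 0 +
      (∑ s ∈ F, (mat s 2 2)⁻¹ ^ 2 * nuB a b s j) * x.1 1 + ∑ s ∈ F, (mat s 2 2)⁻¹ ^ 2 * nuC a b s j := by
    simp only [Q, nu_affine, Finset.sum_mul, ← Finset.sum_add_distrib]
    refine Finset.sum_congr rfl fun s _ => ?_; ring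
  rw [hQ, hA0, hB, h0]
  ring

end K1

/-- **The residual of the S1 strength verdict, DISCHARGED.** -/
theorem orbitSpansDisjoint : OrbitSpansDisjoint :=
  orbitSpansDisjoint_of_classVanishing classVanishing

/-- An unconditional `SplitHolConfig`. -/
def splitHolConfig : S1StrengthCR.SplitHolConfig := splitHolConfig_of_disjoint orbitSpansDisjoint

end SplitHolForms
end PerL34
end HodgeCM

end

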